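import Summits.ResolutionOfSingularities.ResolutionOfSingularities.Theorems.MarkedTransferCampaignW46MohWindowShadeFormalSeries
import Summits.ResolutionOfSingularities.ResolutionOfSingularities.Theorems.MarkedTransferCampaignW46MohWindowShadeFormalFinite
import HarnessLib

/-!
# [OURS · L1 W4.6 rung (iii)] The formally purely inseparable surface window with POWER-SERIES residual part and ISOLATED SURFACE
# SINGULARITY — res-D-pv-008 AS s46-pv-14's clause (R1) verbatim, under the classical isolatedness hypothesis: regime, rung, and the
# closers (statement typing + nesting + closers by reduction to the formally-polynomial rung)

Cell `res-hironaka`, LADDER-RESOLUTION rung L (D-0089), slot W4.6 rung (iii) «purely inseparable `z^p = f(x, y)` with `ord f < 2p`»; seat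
res-L1-s46-pv-6 (gen 5). Host route MarkedTransfer (`HypersurfaceOrderReduction`, stmt-ResolutionOfSingularities-16155), `--supports … --as
helper`; kind definition (TYPED-OURS: 3 definitions + nesting + closers). Sibling of `…MohWindowShadeFormalStatement.lean` (p531101).

WHAT IS TYPED
* `CampaignW46.MohWindowSurfaceFormalSeriesAt p K R I` (ring level, `K : Type`): for SOME ring isomorphism `e : R̂ ≃+* K⟦z, u₀, u₁⟧`, some
  `f₀` with `I = (f₀)`, some unit `w` and some POWER SERIES `F ∈ K⟦y₀, y₁⟧` without `p`-th power monomials, with `p < ord F < 2p`: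
  `e f₀ = w · (z^p + F(u₀, u₁))` (`F(u₀, u₁) = rename some F`), AND the germ `z^p + F(u₀, u₁)` has an ISOLATED SURFACE SINGULARITY in the sense
  of Boubakri–Greuel–Markwig (`IsIsolatedHypersurface`: the Tjurina algebra `K⟦X⟧/(g, ∂g)` is finite over `K`; read after the renaming
  `Option (Fin 2) ≃ Fin 3`). This is pv-14's clause (R1) («`∃ e : 𝒪̂_ξ ≃+* κ⟦X⟧, e(J𝒪̂) = (X₂^p + F), F free of X₂`») in the window, with the
  classical isolatedness hypothesis of Hauser 2010 / Hauser–Wagner 2014 (isolated SURFACE singularity — stronger than o1's isolated `p`-fold locus).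
* `CampaignW46.Regime.mohWindowSurfaceFormalSeries := regimeMohWindowSurfaceInsep ∧ ∀ ξ ∈ Sing(E), MohWindowSurfaceFormalSeriesAt p K 𝒪_{Z,ξ} J_ξ`.
* `CampaignW46.MohWindowSurfaceFormalSeriesPermissiblyTerminates p K := PermissiblyTerminates Regime.mohWindowSurfaceFormalSeries`.
NESTING AND CLOSERS (all by REDUCTION to the formally-polynomial rung through CONTACT FINITE DETERMINACY, `…FormalSeries.formalPolyAt_of_formalSeries`,
Boubakri–Greuel–Markwig Thm. 2.1 PROVED in the tree): `MohWindowSurfaceFormalSeriesAt.formalPolyAt`, `Regime.mohWindowSurfaceFormalSeries_le_formalPoly`;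
`mohWindowSurfaceFormalSeriesPermissiblyTerminates_of_isAlgClosed` (p532859), `…_of_finite` (`…FormalFinite`), `…_rationalSing` (every perfect
field, rational singular points), typed `Terminates`/`TerminatesNabla`; implied by o1's `MohWindowSurfaceInsepPermissiblyTerminates` (antitone).

(VAC) VACUITY SELF-CHECK. Not trivially true: `z^p + u₀^(p+1) + u₁^(p+1)` (gen 4's witness p522062, via Poly ≤ FormalPoly) has Tjurina ideal
`(g, u₀^p, u₁^p)` of finite colength, so it inhabits this regime too — NOT proved in the tree (the Tjurina finiteness of that example is not kernel-checked;
disclosed); the regime is a SUB-regime of `Regime.mohWindowSurfaceFormalPoly` by the nesting theorem, so every rung here is at most as strong as there.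
Not trivially false: no in-tree refutation; arbitrarily long in-window chains exist (gen 2). AI-written; AI review is weaker than expert review.
H. Hironaka, ms. 2017-03-23, Th. 16.6 p.84 l.4–20, Th. 16.13 p.87 l.26–28 — scope only, under adjudication, not cited as fact. [Hironaka2017]
References: Y. Boubakri, G.-M. Greuel, T. Markwig, Rev. Mat. Complut. 25 (2012) Thm. 2.1 [BoubakriGreuelMarkwig2010]; H. Hauser, Bull. AMS 47 (2010)
§§F–G [Hauser2010].
-/

noncomputable section

set_option linter.dupNamespace false -- mandated namespace of this single-conjunct summit

open CategoryTheory AlgebraicGeometry TopologicalSpace IsLocalRing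

namespace Summit.ResolutionOfSingularities.ResolutionOfSingularities.Theorems

namespace CampaignW46

open Literature.AlgebraicGeometry.Resolution
open Literature.AlgebraicGeometry.Resolution.Hauser2010
open Literature.AlgebraicGeometry.Resolution.BoubakriGreuelMarkwig
open Literature.AlgebraicGeometry.Hironaka2017.S02Preliminaries
open Literature.AlgebraicGeometry.Hironaka2017.Datum

variable {p : ℕ} [Fact p.Prime] {K : Type} [Field K] [CharP K p]

/-! ## §1 The predicate (ring level) -/

/-- [OURS · L1 W4.6 rung (iii)] replaces the role of the hypothesis «purely inseparable SURFACE `z^p = F(x, y)` with `p < ord F < 2p` and ISOLATED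
SINGULARITY» (RESCUE-SEED W4.6 (iii); Hauser 2010 §F) READ IN THE COMPLETION with a POWER-SERIES residual part — res-D-pv-008 AS s46-pv-14's
clause (R1); NOT a statement of the manuscript. For a local ring `R` and an ideal `I`: for SOME ring isomorphism `e : R̂ ≃+* K⟦z, u₀, u₁⟧`
(`z = X none`, `u_l = X (some l)`), some `f₀` with `I = (f₀)`, some unit `w` and some power series `F ∈ K⟦y₀, y₁⟧` with no `p`-th power monomials
and `p < ord F < 2p`: `e f₀ = w · (z^p + F(u₀, u₁))`, and `z^p + F(u₀, u₁)` is an isolated hypersurface singularity in the sense of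
Boubakri–Greuel–Markwig (finite Tjurina algebra, read after renaming the variables to `Fin 3`).
[cite: Hauser2010, §F (setting f = x^p + y^r g)] [cite: BoubakriGreuelMarkwig2010, §1 (p. 3)] -/
def MohWindowSurfaceFormalSeriesAt (p : ℕ) (K : Type) [Field K] (R : Type) [CommRing R] [IsLocalRing R] (I : Ideal R) : Prop :=
  ∃ (e : AdicCompletion (maximalIdeal R) R ≃+* MvPowerSeries (Option (Fin 2)) K) (f₀ : R) (w : MvPowerSeries (Option (Fin 2)) K)
    (F : MvPowerSeries (Fin 2) K),
    (∀ d : Fin 2 →₀ ℕ, IsPthPowerExponent p d → MvPowerSeries.coeff d F = 0) ∧ (p : ℕ∞) < F.order ∧ F.order < (2 * p : ℕ) ∧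
      I = Ideal.span {f₀} ∧ IsUnit w ∧
      e (algebraMap R (AdicCompletion (maximalIdeal R) R) f₀) =
        w * (MvPowerSeries.X none ^ p + MvPowerSeries.rename (some : Fin 2 → Option (Fin 2)) F) ∧
      IsIsolatedHypersurface (MvPowerSeries.renameEquiv K MohWindowShadeFormalSeries.optionFinTwoEquiv
        (MvPowerSeries.X none ^ p + MvPowerSeries.rename (some : Fin 2 → Option (Fin 2)) F))

omit [CharP K p] in
/-- **Series ⇒ Poly** (contact finite determinacy, `…FormalSeries.formalPolyAt_of_formalSeries`). NOT a statement of the manuscript.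
[cite: BoubakriGreuelMarkwig2010, Thm. 2.1] -/
theorem MohWindowSurfaceFormalSeriesAt.formalPolyAt {R : Type} [CommRing R] [IsLocalRing R] {I : Ideal R}
    (h : MohWindowSurfaceFormalSeriesAt p K R I) : MohWindowSurfaceFormalPolyAt p K R I := by
  obtain ⟨e, f₀, w, F, hclean, hpF, hF2, hI, hw, hE, hτ⟩ := h
  exact MohWindowShadeFormalSeries.formalPolyAt_of_formalSeries e f₀ w hw F hclean hpF hF2 hI hE hτ

/-! ## §2 The regime and the rung -/

/-- [OURS · L1 W4.6 rung (iii)] **Regime «formally purely inseparable surface window, power-series residual part, isolated surface singularity»**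
— replaces the role of the restriction (iii) of RESCUE-SEED W4.6 read in the completed local rings at EVERY stage; NOT a statement of the manuscript:
o1's `regimeMohWindowSurfaceInsep` AND `MohWindowSurfaceFormalSeriesAt p K 𝒪_{Z,ξ} J_ξ` at every `ξ ∈ Sing(E)`. [folklore] -/
def Regime.mohWindowSurfaceFormalSeries : Regime p K := fun A E =>
  regimeMohWindowSurfaceInsep A E ∧ ∀ ξ ∈ E.sing, MohWindowSurfaceFormalSeriesAt p K (A.Z.presheaf.stalk ξ) (stalkIdeal E.J ξ)

/-- Pure logic + determinacy: the series regime is a sub-regime of the formally-polynomial regime (p531101). [folklore] -/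
theorem Regime.mohWindowSurfaceFormalSeries_le_formalPoly (A : AmbientDatum p K) (E : IdealExponent A.Z)
    (h : Regime.mohWindowSurfaceFormalSeries A E) : Regime.mohWindowSurfaceFormalPoly A E :=
  ⟨h.1, fun ξ hξ => (h.2 ξ hξ).formalPolyAt⟩

/-- Pure logic: … and of o1's regime of record. [folklore] -/
theorem Regime.mohWindowSurfaceFormalSeries_le (A : AmbientDatum p K) (E : IdealExponent A.Z)
    (h : Regime.mohWindowSurfaceFormalSeries A E) : regimeMohWindowSurfaceInsep A E :=
  h.1

/-- [OURS · L1 W4.6 rung (iii)] **RUNG (iii), FORMALLY PURELY INSEPARABLE SURFACE WINDOW WITH POWER-SERIES RESIDUAL PART AND ISOLATED SURFACE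
SINGULARITY, résumé-free** — replaces the role of the termination clause of Th. 16.13 p.87 l.26–28 for the typed Th. 16.6 procedure restricted, at
every stage, to `Regime.mohWindowSurfaceFormalSeries`; NOT a statement of the manuscript: NO infinite §2.1-permissible sequence all of whose stages
lie in the regime (`PermissiblyTerminates`). PROVED over algebraically closed and over finite `K` (below). VACUITY: module docstring (VAC). [folklore] -/
def MohWindowSurfaceFormalSeriesPermissiblyTerminates (p : ℕ) [Fact p.Prime] (K : Type) [Field K] [CharP K p] : Prop :=
  PermissiblyTerminates (Regime.mohWindowSurfaceFormalSeries (p := p) (K := K))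

/-! ## §3 Nesting and closers -/

/-- Pure logic (antitonicity): the formally-polynomial rung implies the series rung. [folklore] -/
theorem mohWindowSurfaceFormalSeriesPermissiblyTerminates_of_formalPoly (h : MohWindowSurfaceFormalPolyPermissiblyTerminates p K) :
    MohWindowSurfaceFormalSeriesPermissiblyTerminates p K :=
  permissiblyTerminates_antitone (fun A E hAE => Regime.mohWindowSurfaceFormalSeries_le_formalPoly A E hAE) h

/-- Pure logic (antitonicity): o1's rung `MohWindowSurfaceInsepPermissiblyTerminates` implies the series rung. [folklore] -/
theorem mohWindowSurfaceFormalSeriesPermissiblyTerminates_of_insep (h : MohWindowSurfaceInsepPermissiblyTerminates p K) :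
    MohWindowSurfaceFormalSeriesPermissiblyTerminates p K :=
  permissiblyTerminates_antitone (fun A E hAE => Regime.mohWindowSurfaceFormalSeries_le A E hAE) h

variable (p) (K)

/-- **RUNG (iii), FORMAL SERIES WINDOW WITH ISOLATED SURFACE SINGULARITY — CLOSED BY NAME over algebraically closed fields.** [OURS · L1 W4.6 rung
(iii)] NOT a statement of the manuscript (p532859 ∘ determinacy). [cite: BoubakriGreuelMarkwig2010, Thm. 2.1] [cite: Hauser2010, §F (setting f = x^p + y^r g)] -/
theorem mohWindowSurfaceFormalSeriesPermissiblyTerminates_of_isAlgClosed [IsAlgClosed K] : MohWindowSurfaceFormalSeriesPermissiblyTerminates p K :=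
  mohWindowSurfaceFormalSeriesPermissiblyTerminates_of_formalPoly (mohWindowSurfaceFormalPolyPermissiblyTerminates_of_isAlgClosed p K)

/-- **… and over every FINITE field.** [OURS · L1 W4.6 rung (iii)] NOT a statement of the manuscript (`…FormalFinite` ∘ determinacy). [folklore] -/
theorem mohWindowSurfaceFormalSeriesPermissiblyTerminates_of_finite [Finite K] : MohWindowSurfaceFormalSeriesPermissiblyTerminates p K :=
  mohWindowSurfaceFormalSeriesPermissiblyTerminates_of_formalPoly (mohWindowSurfaceFormalPolyPermissiblyTerminates_of_finite p K)

/-- **… and over every PERFECT field as long as the singular points stay rational.** [OURS · L1 W4.6 rung (iii)] NOT a statement of the manuscript.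
[folklore] -/
theorem mohWindowSurfaceFormalSeries_rationalSing_permissiblyTerminates [PerfectField K] :
    PermissiblyTerminates (Regime.inter (Regime.mohWindowSurfaceFormalSeries (p := p) (K := K)) Regime.rationalSing) :=
  permissiblyTerminates_antitone (fun A E hAE => ⟨Regime.mohWindowSurfaceFormalSeries_le_formalPoly A E hAE.1, hAE.2⟩)
    (mohWindowSurfaceFormalPoly_rationalSing_permissiblyTerminates p K)

/-- **The typed rungs** over an algebraically closed field: `Terminates ∧ TerminatesNabla` on `Regime.mohWindowSurfaceFormalSeries` for EVERY notion
instance `N` and reading `Rd`. [OURS · L1 W4.6 rung (iii)] NOT a statement of the manuscript. [folklore] -/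
theorem terminates_mohWindowSurfaceFormalSeries_of_isAlgClosed [IsAlgClosed K] (n : ℕ) (N : Notions.{0} n) (Rd : Reading p K N) :
    Terminates N Rd (Regime.mohWindowSurfaceFormalSeries (p := p) (K := K)) ∧
      TerminatesNabla N Rd (Regime.mohWindowSurfaceFormalSeries (p := p) (K := K)) :=
  ⟨terminates_of_permissiblyTerminates N Rd (mohWindowSurfaceFormalSeriesPermissiblyTerminates_of_isAlgClosed p K),
    terminatesNabla_of_terminates
      (terminates_of_permissiblyTerminates N Rd (mohWindowSurfaceFormalSeriesPermissiblyTerminates_of_isAlgClosed p K))⟩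

end CampaignW46

end Summit.ResolutionOfSingularities.ResolutionOfSingularities.Theorems

end
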